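import Literature.Probability.LatticeModels.SpinPolygonDomain
import Literature.Probability.LatticeModels.InterfaceSLETightness
import Literature.Probability.LatticeModels.IsingMultiCrossing
import HarnessLib

/-!
# Sectors of an annulus cut by the leftmost Ising interface: separated `+` arms

Topic `Literature/Probability/LatticeModels` (trunk `StatMech`, family `crit-ising`). The
deterministic core of the Aizenman–Burchard regularity criterion (Duke Math. J. 99 (1999),
App. A, Lemma A.5) for the **leftmost** Dobrushin interface of a spin configuration in a
discretised Dobrushin domain `(Ω_δ, a_δ, b_δ)` approximating a Jordan domain `D`
(`D'.Ω = D.carrier`, admissible data), in the ONE-SIDED `+` form consumed by the successive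
conditioning of `IsingMultiCrossing.lean` (no BK inequality for the Ising model): if the polygon
`spinPolygon δ (leftmostInterface D' σ)` traverses a shell `D(x; ρ, R)` `2(j + N)` times, then
`σ` contains `j` local `+` paths across a square band of lattice levels about `x`, lying in
pairwise distinct local `+` clusters of the free sites of the band, none locally joined to a free
site next to the `+` arc (`plusArmsAvoiding_of_hasTraversals`). This is the spin counterpart of
`MedialTraversalSectors.fkArms_of_hasTraversals`, with the cut set `leftCut` of
`SpinPolygonDomain.lean` in place of the perturbed medial polygon and the `+` left chain of
`LeftmostInterface.lean` (consecutive left sites joined by `+` edges of `Ω_δ`, which miss the cut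
set) in place of the chain of open edges. Ingredients: tight arcs of the traversals
(`TightPolyline.exists_tight_polyline`) are pairwise disjoint (`leftChord_disjoint`), so by the
three-arcs lemma (`AnnulusArcs.not_three_arcs_touch`) a component of the annulus minus the cut set
is the left sector of at most two traversals; at most `N = ⌊1/θ⌋₊ + 1` sectors contain a boundary
point in the middle of the annulus (`card_le_of_separated_frontier_points`); an untainted sector
carries its left chain inside the free volume, and `+` paths of the band never leave a sector.

## References

* M. Aizenman, A. Burchard, *Hölder regularity and dimension bounds for random curves*, Duke
  Math. J. 99 (1999), Appendix A, Lemma A.5. [AizenmanBurchardDuke1999]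
* A. Kemppainen, S. Smirnov, Ann. Probab. 45 (2017), Rem. 2.10 and §3. [KemppainenSmirnov2017]
* D. Chelkak, H. Duminil-Copin, C. Hongler, A. Kemppainen, S. Smirnov, C. R. Math. Acad. Sci.
  Paris 352 (2014), §1–§2. [CDHKSCRAS2014]
-/

noncomputable section

namespace Literature.Probability.LatticeModels

open Set Metric Complex Literature.Probability.Percolation Literature.Topology.PlaneTopology
open scoped Pointwise

variable {D : DiscreteDobrushin}

/-! ### The polygon of the leftmost interface: vertices, pieces and the piece index of a time -/

/-- The `k`-th vertex of the polygon of the leftmost interface in the plane. [cite: CDHKSCRAS2014, §1] -/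
def leftPt (D : DiscreteDobrushin) (σ : SpinConfig (Site 2)) (k : ℕ) : ℂ :=
  dualMedialPoint D.δ s(leftOrbit D σ k, leftOrbit D σ (k + 1))

variable (σ : SpinConfig (Site 2))

/-- The vertex is the scaled lattice vertex. [folklore] -/
theorem leftPt_eq (k : ℕ) : leftPt D σ k = (D.δ : ℂ) * leftVert D σ k := dualMedialPoint_leftOrbit σ k

/-- The piece is the segment between consecutive vertices. [folklore] -/
theorem leftPiece_eq (k : ℕ) : leftPiece D σ k = segment ℝ (leftPt D σ k) (leftPt D σ (k + 1)) :=
  leftPiece_eq_segment σ k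

/-- The polygon of the leftmost interface is the polyline through its vertices. [cite: CDHKSCRAS2014, §1] -/
theorem spinPolygon_leftmostInterface (D : DiscreteDobrushin) (σ : SpinConfig (Site 2)) :
    spinPolygon D.δ (leftmostInterface D σ) = ⟨polyline ((List.range (leftLength D σ + 1)).map (leftPt D σ))⟩ := by
  rw [spinPolygon_eq, leftmostInterface, List.map_map]
  rfl

/-- The vertex list as head and tail. [folklore] -/
theorem map_leftPt_eq_cons (D : DiscreteDobrushin) (σ : SpinConfig (Site 2)) :
    (List.range (leftLength D σ + 1)).map (leftPt D σ) =
      leftPt D σ 0 :: (List.range (leftLength D σ)).map (fun k ↦ leftPt D σ (k + 1)) := by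
  rw [List.range_succ_eq_map, List.map_cons, List.map_map]
  rfl

/-- The **piece index of a time**: the index of the piece of the polygon traversed at time `u`
(the last piece on the final constant stretch). [folklore] -/
def lIdx (D : DiscreteDobrushin) (σ : SpinConfig (Site 2)) (u : unitInterval) : ℕ :=
  min (pieceIdx ((List.range (leftLength D σ)).map (fun k ↦ leftPt D σ (k + 1))) u) (leftLength D σ - 1)

/-- The piece index is monotone in time. [folklore] -/
theorem lIdx_mono {u v : unitInterval} (h : u ≤ v) : lIdx D σ u ≤ lIdx D σ v :=
  min_le_min_right _ (pieceIdx_mono _ h)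

/-- The piece index is at most `N - 1`. [folklore] -/
theorem lIdx_le (u : unitInterval) : lIdx D σ u ≤ leftLength D σ - 1 := min_le_right _ _

variable {σ}

/-- **At every time the polygon is on the piece of its piece index** (`N ≥ 1`). [cite: CDHKSCRAS2014, §1] -/
theorem spinPolygon_mem_leftPiece (hD : D.IsZdAdmissible) (σ : SpinConfig (Site 2)) (u : unitInterval) :
    spinPolygon D.δ (leftmostInterface D σ) u ∈ leftPiece D σ (lIdx D σ u) := by
  have hN := one_le_leftLength hD σ
  rw [spinPolygon_leftmostInterface, map_leftPt_eq_cons]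
  set l := (List.range (leftLength D σ)).map (fun k ↦ leftPt D σ (k + 1)) with hl
  have hlen : l.length = leftLength D σ := by rw [hl, List.length_map, List.length_range]
  change (polylineFrom (leftPt D σ 0) l).2 u ∈ leftPiece D σ (lIdx D σ u)
  have hmem := polylineFrom_mem_segment_pieceAt (leftPt D σ 0) l u
  have hlget : ∀ i (hi : i < l.length), l[i] = leftPt D σ (i + 1) := by
    intro i hi; simp [hl]
  have hconsget : ∀ i (hi : i < (leftPt D σ 0 :: l).length), (leftPt D σ 0 :: l)[i] = leftPt D σ i := by
    intro i hi
    cases i with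
    | zero => rfl
    | succ i => rw [List.getElem_cons_succ, hlget]
  rcases pieceAt_eq_getElem_or (leftPt D σ 0) l u with ⟨h, heq⟩ | ⟨hidx, heq⟩
  · have hi : pieceIdx l u < leftLength D σ := by
      rw [List.length_zip, List.length_cons, hlen] at h
      omega
    have hlIdx : lIdx D σ u = pieceIdx l u := by
      rw [lIdx, ← hl]; exact min_eq_left (by omega)
    rw [heq, List.getElem_zip, hconsget, hlget] at hmem
    rw [hlIdx, leftPiece_eq]
    exact hmem
  · have hlIdx : lIdx D σ u = leftLength D σ - 1 := by
      rw [lIdx, ← hl, hidx, hlen]; exact min_eq_right (Nat.sub_le _ _)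
    rw [heq] at hmem
    have hlast : (leftPt D σ 0 :: l).getLast (by simp) = leftPt D σ (leftLength D σ) := by
      rw [List.getLast_eq_getElem, hconsget, List.length_cons, hlen, Nat.add_sub_cancel]
    rw [hlast, segment_same, mem_singleton_iff] at hmem
    rw [hmem, hlIdx, leftPiece_eq, show leftLength D σ - 1 + 1 = leftLength D σ by omega]
    exact right_mem_segment _ _ _

/-! ### Distances: pieces are small and close to their left sites -/

/-- **Every point of the `k`-th piece is within `2δ` of the left sites `k` and `k + 1`** (both are
corners of the face `orb (k+1)` containing the piece). [cite: CDHKSCRAS2014, §1] -/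
theorem dist_leftSite_le_of_mem_leftPiece (hD : D.IsZdAdmissible) (σ : SpinConfig (Site 2)) {k : ℕ}
    (hk : k + 1 ≤ leftLength D σ) {z : ℂ} (hz : z ∈ leftPiece D σ k) :
    dist (meshPoint D.δ (leftSite D σ k)) z ≤ 2 * D.δ ∧ dist (meshPoint D.δ (leftSite D σ (k + 1))) z ≤ 2 * D.δ := by
  have hδ := hD.delta_pos
  have hz' := leftChord_subset_closedSq hD σ hk ((mem_leftPiece_iff hδ.ne').1 hz)
  have key : ∀ v, IsCorner v (leftOrbit D σ (k + 1)) → dist (meshPoint D.δ v) z ≤ 2 * D.δ := by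
    intro v hv
    have h := closedSq_subset_closedBall hv hz'
    rw [mem_closedBall, dist_comm] at h
    rw [meshPoint_eq_smul, ← smul_inv_smul₀ hδ.ne' z, dist_smul₀, Real.norm_eq_abs, abs_of_pos hδ]
    nlinarith
  exact ⟨key _ (isCorner_leftSite hD σ (Nat.le_of_succ_le hk)).2, key _ (isCorner_leftSite hD σ hk).1⟩

/-- Points of the same piece or of consecutive pieces are within `4δ`. [folklore] -/
theorem dist_le_of_mem_leftPiece_near (hD : D.IsZdAdmissible) (σ : SpinConfig (Site 2)) {p p' : ℕ}
    (hp' : p' + 1 ≤ leftLength D σ) (h1 : p ≤ p') (h2 : p' ≤ p + 1) {z z' : ℂ}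
    (hz : z ∈ leftPiece D σ p) (hz' : z' ∈ leftPiece D σ p') : dist z z' ≤ 4 * D.δ := by
  rcases Nat.eq_or_lt_of_le h1 with rfl | hlt
  · have a := (dist_leftSite_le_of_mem_leftPiece hD σ hp' hz).1
    have b := (dist_leftSite_le_of_mem_leftPiece hD σ hp' hz').1
    linarith [dist_triangle z (meshPoint D.δ (leftSite D σ p)) z', dist_comm z (meshPoint D.δ (leftSite D σ p))]
  · obtain rfl : p' = p + 1 := by omega
    have a := (dist_leftSite_le_of_mem_leftPiece hD σ (by omega) hz).2
    have b := (dist_leftSite_le_of_mem_leftPiece hD σ hp' hz').1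
    linarith [dist_triangle z (meshPoint D.δ (leftSite D σ (p + 1))) z', dist_comm z (meshPoint D.δ (leftSite D σ (p + 1)))]

/-- Pieces carrying points whose distances from `x` differ by more than `4δ` are at index
distance `≥ 2`. [folklore] -/
theorem two_le_dist_index_left (hD : D.IsZdAdmissible) (σ : SpinConfig (Site 2)) {p p' : ℕ} {x z z' : ℂ}
    (hp : p + 1 ≤ leftLength D σ) (hp' : p' + 1 ≤ leftLength D σ) (hz : z ∈ leftPiece D σ p) (hz' : z' ∈ leftPiece D σ p')
    (hfar : 4 * D.δ < |dist z x - dist z' x|) : p + 2 ≤ p' ∨ p' + 2 ≤ p := by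
  by_contra h
  push Not at h
  have h1 := abs_dist_sub_le z z' x
  rcases le_total p p' with hle | hle
  · have := dist_le_of_mem_leftPiece_near hD σ hp' hle (by omega) hz hz'
    linarith
  · have := dist_le_of_mem_leftPiece_near hD σ hp hle (by omega) hz' hz
    rw [dist_comm] at this
    linarith

/-- The polygon at time `u` is within `2δ` of the left site `lIdx u + 1`. [folklore] -/
theorem dist_spinPolygon_leftSite_le (hD : D.IsZdAdmissible) (σ : SpinConfig (Site 2)) (u : unitInterval) :
    dist (spinPolygon D.δ (leftmostInterface D σ) u) (meshPoint D.δ (leftSite D σ (lIdx D σ u + 1))) ≤ 2 * D.δ := by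
  have hN := one_le_leftLength hD σ
  have h := (dist_leftSite_le_of_mem_leftPiece hD σ (k := lIdx D σ u) (by have := lIdx_le (D := D) σ u; omega)
    (spinPolygon_mem_leftPiece hD σ u)).2
  rwa [dist_comm] at h

/-! ### One traversal: the tight arc, the middle piece and the left chain -/

/-- **The tight arc of a traversal of the leftmost-interface polygon.** Let the polygon traverse
the shell `D(x; ρ, R)` between the times `s ≤ t`, and let `ρ + 5δ < q₁`, `q₂ + 5δ < R`,
`q₁ + 7δ ≤ r₁`, `r₂ + 7δ ≤ q₂`, `r₁ + 40δ ≤ r₂`. Then the pieces with indices in some range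
`[pl, ph] ⊆ (lIdx s, lIdx t)` — in particular `1 ≤ pl`, `ph ≤ N - 2`, so they lie in the cut set —
carry a path `T` from a point `E` of the circle of radius `q₁` to a point `F` of the circle of radius
`q₂`, inside the closed annulus and meeting each circle only at the corresponding endpoint; a whole
piece `m` lies on `T`; and the left sites `i' ≤ i ≤ j'` (`pl < i'`, `j' < ph`, `i' ≤ m ≤ j'`) are at
distance in `(r₁ - 3δ, r₂ + 3δ)` from `x`, the pieces `i' ≤ i < j'` carrying only points at distance in
`(r₁, r₂)`, the first site within `r₁ + 3δ` and the last beyond `r₂ - 3δ` or conversely.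
(Aizenman–Burchard 1999, App. A: the crossing segment of a traversal and the path along its side.)
[cite: AizenmanBurchardDuke1999, Appendix A, Lemma A.5] -/
theorem exists_traversal_arc_left (hD : D.IsZdAdmissible) (σ : SpinConfig (Site 2)) {x : ℂ} {ρ R q₁ q₂ r₁ r₂ : ℝ}
    (hq₁ : ρ + 5 * D.δ < q₁) (hq₂ : q₂ + 5 * D.δ < R) (hr₁ : q₁ + 7 * D.δ ≤ r₁) (hr₂ : r₂ + 7 * D.δ ≤ q₂)
    (hr : r₁ + 40 * D.δ ≤ r₂) {s t : unitInterval}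
    (hst : (spinPolygon D.δ (leftmostInterface D σ)).IsTraversal x ρ R s t) :
    ∃ (pl ph : ℕ) (E F : ℂ) (T : Path E F) (m i' j' : ℕ),
      lIdx D σ s < pl ∧ pl < ph ∧ ph < lIdx D σ t ∧ 1 ≤ pl ∧ ph + 2 ≤ leftLength D σ ∧
      dist E x = q₁ ∧ dist F x = q₂ ∧
      range T ⊆ (⋃ p ∈ Finset.Icc pl ph, leftPiece D σ p) ∧ range T ⊆ leftCut D σ ∧
      (∀ z ∈ range T, q₁ ≤ dist z x ∧ dist z x ≤ q₂ ∧ (dist z x = q₁ → z = E) ∧ (dist z x = q₂ → z = F)) ∧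
      leftPiece D σ m ⊆ range T ∧
      i' ≤ m ∧ m ≤ j' ∧ pl < i' ∧ j' < ph ∧
      (∀ i, i' ≤ i → i ≤ j' → r₁ - 3 * D.δ < dist (meshPoint D.δ (leftSite D σ i)) x ∧
        dist (meshPoint D.δ (leftSite D σ i)) x < r₂ + 3 * D.δ) ∧
      (∀ i, i' ≤ i → i < j' → ∀ z ∈ leftPiece D σ i, r₁ < dist z x ∧ dist z x < r₂) ∧
      ((dist (meshPoint D.δ (leftSite D σ i')) x ≤ r₁ + 3 * D.δ ∧ r₂ - 3 * D.δ ≤ dist (meshPoint D.δ (leftSite D σ j')) x) ∨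
        (r₂ - 3 * D.δ ≤ dist (meshPoint D.δ (leftSite D σ i')) x ∧ dist (meshPoint D.δ (leftSite D σ j')) x ≤ r₁ + 3 * D.δ)) := by
  have hδ := hD.delta_pos
  have hN := one_le_leftLength hD σ
  set N := leftLength D σ with hNdef
  set γ : unitInterval → ℂ := fun u ↦ spinPolygon D.δ (leftmostInterface D σ) u with hγ
  have hγmem : ∀ u, γ u ∈ leftPiece D σ (lIdx D σ u) := fun u ↦ spinPolygon_mem_leftPiece hD σ u
  have hidx : ∀ u, lIdx D σ u + 1 ≤ N := fun u ↦ by have := lIdx_le (D := D) σ u; omega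
  obtain ⟨hst0, hends⟩ := hst
  change (dist (γ s) x ≤ ρ ∧ R ≤ dist (γ t) x) ∨ (R ≤ dist (γ s) x ∧ dist (γ t) x ≤ ρ) at hends
  -- pieces are small
  have hsmall : ∀ {p : ℕ} {z w : ℂ}, p + 1 ≤ N → z ∈ leftPiece D σ p → w ∈ leftPiece D σ p → dist z w ≤ 4 * D.δ :=
    fun {p z w} hp hz hw ↦ dist_le_of_mem_leftPiece_near hD σ hp le_rfl (Nat.le_succ p) hz hw
  have hstart_mem : ∀ u, leftPt D σ (lIdx D σ u) ∈ leftPiece D σ (lIdx D σ u) := fun u ↦ by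
    rw [leftPiece_eq]; exact left_mem_segment _ _ _
  have hend_mem : ∀ u, leftPt D σ (lIdx D σ u + 1) ∈ leftPiece D σ (lIdx D σ u) := fun u ↦ by
    rw [leftPiece_eq]; exact right_mem_segment _ _ _
  set ps := lIdx D σ s with hps
  set pe := lIdx D σ t with hpe
  have hpse : ps ≤ pe := lIdx_mono σ hst0
  have hdiam : ∀ {c : ℝ}, 4 * D.δ < c → ∀ p, ps ≤ p → p ≤ pe → ∀ z ∈ segment ℝ (leftPt D σ p) (leftPt D σ (p + 1)),
      ∀ w ∈ segment ℝ (leftPt D σ p) (leftPt D σ (p + 1)), dist z w < c := by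
    intro c hc p _ hp2 z hz w hw
    rw [← leftPiece_eq] at hz hw
    exact (hsmall (by have := hidx t; omega) hz hw).trans_lt hc
  have hq : 4 * D.δ < q₂ - q₁ := by linarith
  have hr' : 4 * D.δ < r₂ - r₁ := by linarith
  /- assembling the conclusion from a first-level stretch `[pl, ph]` and a second-level stretch `[pl', ph']` -/
  have assemble : ∀ (pl ph : ℕ) (E F : ℂ) (T : Path E F) (pl' ph' : ℕ) (E' F' : ℂ) (T' : Path E' F'),
      ps < pl → pl < pl' → pl' < ph' → ph' < ph → ph < pe →
      dist E x = q₁ → dist F x = q₂ →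
      range T ⊆ (⋃ p ∈ Finset.Icc pl ph, leftPiece D σ p) →
      (∀ z ∈ range T, q₁ ≤ dist z x ∧ dist z x ≤ q₂ ∧ (dist z x = q₁ → z = E) ∧ (dist z x = q₂ → z = F)) →
      (∀ p, pl < p → p < ph → leftPiece D σ p ⊆ range T) →
      ((dist E' x = r₁ ∧ dist F' x = r₂) ∨ (dist E' x = r₂ ∧ dist F' x = r₁)) →
      E' ∈ leftPiece D σ pl' → F' ∈ leftPiece D σ ph' →
      range T' ⊆ (⋃ p ∈ Finset.Icc pl' ph', leftPiece D σ p) →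
      (∀ p, pl' < p → p < ph' → ∀ z ∈ leftPiece D σ p, r₁ < dist z x ∧ dist z x < r₂) →
      ∃ (pl ph : ℕ) (E F : ℂ) (T : Path E F) (m i' j' : ℕ),
      lIdx D σ s < pl ∧ pl < ph ∧ ph < lIdx D σ t ∧ 1 ≤ pl ∧ ph + 2 ≤ leftLength D σ ∧
      dist E x = q₁ ∧ dist F x = q₂ ∧
      range T ⊆ (⋃ p ∈ Finset.Icc pl ph, leftPiece D σ p) ∧ range T ⊆ leftCut D σ ∧
      (∀ z ∈ range T, q₁ ≤ dist z x ∧ dist z x ≤ q₂ ∧ (dist z x = q₁ → z = E) ∧ (dist z x = q₂ → z = F)) ∧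
      leftPiece D σ m ⊆ range T ∧
      i' ≤ m ∧ m ≤ j' ∧ pl < i' ∧ j' < ph ∧
      (∀ i, i' ≤ i → i ≤ j' → r₁ - 3 * D.δ < dist (meshPoint D.δ (leftSite D σ i)) x ∧
        dist (meshPoint D.δ (leftSite D σ i)) x < r₂ + 3 * D.δ) ∧
      (∀ i, i' ≤ i → i < j' → ∀ z ∈ leftPiece D σ i, r₁ < dist z x ∧ dist z x < r₂) ∧
      ((dist (meshPoint D.δ (leftSite D σ i')) x ≤ r₁ + 3 * D.δ ∧ r₂ - 3 * D.δ ≤ dist (meshPoint D.δ (leftSite D σ j')) x) ∨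
        (r₂ - 3 * D.δ ≤ dist (meshPoint D.δ (leftSite D σ i')) x ∧ dist (meshPoint D.δ (leftSite D σ j')) x ≤ r₁ + 3 * D.δ)) := by
    intro pl ph E F T pl' ph' E' F' T' h1 h2 h3 h4 h5 hEd hFd hsub htight hwhole hends' hE' hF' hsub' hinner
    have hphN : ph + 2 ≤ N := by have := hidx t; omega
    -- a point of `T'` at the middle distance
    have hT'c : Continuous fun u : unitInterval ↦ dist (T' u) x := T'.continuous.dist continuous_const
    have hmid : (r₁ + r₂) / 2 ∈ Icc (dist (T' 0) x) (dist (T' 1) x) ∨ (r₁ + r₂) / 2 ∈ Icc (dist (T' 1) x) (dist (T' 0) x) := by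
      rw [T'.source, T'.target]
      rcases hends' with ⟨h1, h2⟩ | ⟨h1, h2⟩ <;> rw [h1, h2]
      · left; constructor <;> linarith
      · right; constructor <;> linarith
    obtain ⟨u₀, hu₀⟩ : ∃ u₀ : unitInterval, dist (T' u₀) x = (r₁ + r₂) / 2 := by
      rcases hmid with h | h
      · exact intermediate_value_univ 0 1 hT'c h
      · exact intermediate_value_univ 1 0 hT'c h
    have hz₀ : T' u₀ ∈ ⋃ p ∈ Finset.Icc pl' ph', leftPiece D σ p := hsub' ⟨u₀, rfl⟩
    obtain ⟨p₀, hp₀, hz₀p⟩ := mem_iUnion₂.1 hz₀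
    rw [Finset.mem_Icc] at hp₀
    -- the middle piece is at index distance `≥ 2` from both ends of the second-level stretch
    have hfarl : 4 * D.δ < |dist (T' u₀) x - dist E' x| := by
      rcases hends' with ⟨h, -⟩ | ⟨h, -⟩ <;> rw [hu₀, h]
      · rw [abs_of_pos (by linarith)]; linarith
      · rw [abs_of_neg (by linarith)]; linarith
    have hfarh : 4 * D.δ < |dist (T' u₀) x - dist F' x| := by
      rcases hends' with ⟨-, h⟩ | ⟨-, h⟩ <;> rw [hu₀, h]
      · rw [abs_of_neg (by linarith)]; linarith
      · rw [abs_of_pos (by linarith)]; linarith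
    have hl2 : pl' + 2 ≤ p₀ := by
      rcases two_le_dist_index_left hD σ (p := p₀) (p' := pl') (by omega) (by omega) hz₀p hE' hfarl with h | h <;> omega
    have hh2 : p₀ + 2 ≤ ph' := by
      rcases two_le_dist_index_left hD σ (p := p₀) (p' := ph') (by omega) (by omega) hz₀p hF' hfarh with h | h <;> omega
    -- the chain `i' = pl' + 1 ≤ i ≤ j' = ph'`
    have hchain : ∀ i, pl' + 1 ≤ i → i ≤ ph' → r₁ - 3 * D.δ < dist (meshPoint D.δ (leftSite D σ i)) x ∧
        dist (meshPoint D.δ (leftSite D σ i)) x < r₂ + 3 * D.δ := by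
      intro i hi1 hi2
      rcases Nat.eq_or_lt_of_le hi1 with rfl | hlt
      · -- next to `E'`
        have hd := (dist_leftSite_le_of_mem_leftPiece hD σ (k := pl') (by omega) hE').2
        rcases hends' with ⟨h, -⟩ | ⟨h, -⟩
        · constructor
          · linarith [dist_triangle E' (meshPoint D.δ (leftSite D σ (pl' + 1))) x, dist_comm E' (meshPoint D.δ (leftSite D σ (pl' + 1)))]
          · linarith [dist_triangle (meshPoint D.δ (leftSite D σ (pl' + 1))) E' x]
        · constructor
          · linarith [dist_triangle E' (meshPoint D.δ (leftSite D σ (pl' + 1))) x, dist_comm E' (meshPoint D.δ (leftSite D σ (pl' + 1)))]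
          · linarith [dist_triangle (meshPoint D.δ (leftSite D σ (pl' + 1))) E' x]
      · -- the piece `i - 1` is strictly inside
        obtain ⟨i, rfl⟩ : ∃ i₀, i = i₀ + 1 := ⟨i - 1, by omega⟩
        have hin := hinner i (by omega) (by omega) (leftPt D σ (i + 1))
          (by rw [leftPiece_eq]; exact right_mem_segment _ _ _)
        have hd := (dist_leftSite_le_of_mem_leftPiece hD σ (k := i) (by omega)
          (show leftPt D σ (i + 1) ∈ leftPiece D σ i by rw [leftPiece_eq]; exact right_mem_segment _ _ _)).2
        constructor
        · linarith [dist_triangle (leftPt D σ (i + 1)) (meshPoint D.δ (leftSite D σ (i + 1))) x,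
            dist_comm (leftPt D σ (i + 1)) (meshPoint D.δ (leftSite D σ (i + 1)))]
        · linarith [dist_triangle (meshPoint D.δ (leftSite D σ (i + 1))) (leftPt D σ (i + 1)) x]
    have hcends : (dist (meshPoint D.δ (leftSite D σ (pl' + 1))) x ≤ r₁ + 3 * D.δ ∧
          r₂ - 3 * D.δ ≤ dist (meshPoint D.δ (leftSite D σ ph')) x) ∨
        (r₂ - 3 * D.δ ≤ dist (meshPoint D.δ (leftSite D σ (pl' + 1))) x ∧
          dist (meshPoint D.δ (leftSite D σ ph')) x ≤ r₁ + 3 * D.δ) := by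
      have hdl := (dist_leftSite_le_of_mem_leftPiece hD σ (k := pl') (by omega) hE').2
      have hdh := (dist_leftSite_le_of_mem_leftPiece hD σ (k := ph') (by omega) hF').1
      rcases hends' with ⟨h1, h2⟩ | ⟨h1, h2⟩
      · left
        constructor
        · linarith [dist_triangle (meshPoint D.δ (leftSite D σ (pl' + 1))) E' x]
        · linarith [dist_triangle F' (meshPoint D.δ (leftSite D σ ph')) x, dist_comm F' (meshPoint D.δ (leftSite D σ ph'))]
      · right
        constructor
        · linarith [dist_triangle E' (meshPoint D.δ (leftSite D σ (pl' + 1))) x, dist_comm E' (meshPoint D.δ (leftSite D σ (pl' + 1)))]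
        · linarith [dist_triangle (meshPoint D.δ (leftSite D σ ph')) F' x]
    refine ⟨pl, ph, E, F, T, p₀, pl' + 1, ph', h1, by omega, h5, by omega, hphN, hEd, hFd, hsub, ?_, htight,
      hwhole p₀ (by omega) (by omega), by omega, by omega, by omega, h4, hchain,
      fun i hi1 hi2 z hz ↦ hinner i (by omega) hi2 z hz, hcends⟩
    refine hsub.trans fun z hz ↦ ?_
    obtain ⟨p, hp, hz⟩ := mem_iUnion₂.1 hz
    rw [Finset.mem_Icc] at hp
    exact mem_leftCut_iff.2 ⟨p, by omega, by omega, hz⟩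
  rcases hends with ⟨hs1, ht1⟩ | ⟨hs1, ht1⟩
  · /- inward-to-outward traversal -/
    have hstart : dist (leftPt D σ ps) x < q₁ := by
      have h := hsmall (hidx s) (hstart_mem s) (hγmem s)
      linarith [dist_triangle (leftPt D σ ps) (γ s) x]
    have hend : q₂ < dist (leftPt D σ (pe + 1)) x := by
      have h := hsmall (hidx t) (hγmem t) (hend_mem t)
      linarith [dist_triangle (γ t) (leftPt D σ (pe + 1)) x]
    obtain ⟨p₁, p₂, E, F, T, hp₁, hp₁₂, hp₂, hE, hF, hEd, hFd, hrange, hsub, htight, hlt₂, hgt₁⟩ :=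
      exists_tight_polyline (leftPt D σ) x hpse (hdiam hq) hstart hend
    rw [← leftPiece_eq] at hE hF
    -- `p₁ + 2 ≤ p₂`, `ps < p₁`, `p₂ < pe`
    have hfar : 4 * D.δ < |dist E x - dist F x| := by rw [hEd, hFd, abs_of_neg (by linarith)]; linarith
    have hgap : p₁ + 2 ≤ p₂ := by
      rcases two_le_dist_index_left hD σ (p := p₁) (p' := p₂) (by have := hidx t; omega) (by have := hidx t; omega) hE hF hfar
        with h | h <;> omega
    have hps₁ : ps < p₁ := by
      refine lt_of_le_of_ne hp₁ fun h ↦ ?_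
      have hd := hsmall (hidx s) (hγmem s) (h ▸ hE)
      linarith [dist_triangle E (γ s) x, dist_comm E (γ s)]
    have hp₂e : p₂ < pe := by
      refine lt_of_le_of_ne hp₂ fun h ↦ ?_
      have hd := hsmall (hidx t) (hγmem t) (h ▸ hF)
      linarith [dist_triangle (γ t) F x]
    -- second level on the whole pieces `p₁ < p < p₂`
    have hstart' : dist (leftPt D σ (p₁ + 1)) x < r₁ := by
      have h := hsmall (p := p₁) (by have := hidx t; omega) hE (by rw [leftPiece_eq]; exact right_mem_segment _ _ _)
      linarith [dist_triangle (leftPt D σ (p₁ + 1)) E x, dist_comm (leftPt D σ (p₁ + 1)) E]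
    have hend' : r₂ < dist (leftPt D σ (p₂ - 1 + 1)) x := by
      rw [show p₂ - 1 + 1 = p₂ by omega]
      have h := hsmall (p := p₂) (by have := hidx t; omega) (by rw [leftPiece_eq]; exact left_mem_segment _ _ _) hF
      linarith [dist_triangle F (leftPt D σ p₂) x, dist_comm F (leftPt D σ p₂)]
    obtain ⟨p₁', p₂', E', F', T', hp₁', hp₁₂', hp₂', hE', hF', hEd', hFd', -, hsub', -, hlt₂', hgt₁'⟩ :=
      exists_tight_polyline (leftPt D σ) x (ps := p₁ + 1) (pe := p₂ - 1) (by omega)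
        (fun p h1 h2 ↦ hdiam hr' p (by omega) (by omega)) hstart' hend'
    rw [← leftPiece_eq] at hE' hF'
    refine assemble p₁ p₂ E F T p₁' p₂' E' F' T' hps₁ (by omega) hp₁₂' (by omega) hp₂e hEd hFd
      (fun z hz ↦ by have := hsub hz; simpa only [leftPiece_eq] using this) htight
      (fun p h1 h2 ↦ ?_) (Or.inl ⟨hEd', hFd'⟩) hE' hF' (fun z hz ↦ by have := hsub' hz; simpa only [leftPiece_eq] using this)
      (fun p h1 h2 z hz ↦ ⟨hgt₁' p h1 h2.le z (by rwa [leftPiece_eq] at hz), hlt₂' p (by omega) h2 z (by rwa [leftPiece_eq] at hz)⟩)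
    rw [hrange, leftPiece_eq]
    intro z hz
    exact Or.inl (Or.inr (mem_iUnion₂.2 ⟨p, Finset.mem_Ioo.2 ⟨h1, h2⟩, hz⟩))
  · /- outward-to-inward traversal -/
    have hstart : q₂ < dist (leftPt D σ ps) x := by
      have h := hsmall (hidx s) (hstart_mem s) (hγmem s)
      linarith [dist_triangle (γ s) (leftPt D σ ps) x, dist_comm (γ s) (leftPt D σ ps)]
    have hend : dist (leftPt D σ (pe + 1)) x < q₁ := by
      have h := hsmall (hidx t) (hγmem t) (hend_mem t)
      linarith [dist_triangle (leftPt D σ (pe + 1)) (γ t) x, dist_comm (leftPt D σ (pe + 1)) (γ t)]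
    obtain ⟨p₁, p₂, E, F, T, hp₂, hp₂₁, hp₁, hE, hF, hEd, hFd, hrange, hsub, htight, hlt₂, hgt₁⟩ :=
      exists_tight_polyline' (leftPt D σ) x hpse (hdiam hq) hstart hend
    rw [← leftPiece_eq] at hE hF
    have hfar : 4 * D.δ < |dist E x - dist F x| := by rw [hEd, hFd, abs_of_neg (by linarith)]; linarith
    have hgap : p₂ + 2 ≤ p₁ := by
      rcases two_le_dist_index_left hD σ (p := p₁) (p' := p₂) (by have := hidx t; omega) (by have := hidx t; omega) hE hF hfar
        with h | h <;> omega
    have hps₂ : ps < p₂ := by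
      refine lt_of_le_of_ne hp₂ fun h ↦ ?_
      have hd := hsmall (hidx s) (hγmem s) (h ▸ hF)
      linarith [dist_triangle (γ s) F x]
    have hp₁e : p₁ < pe := by
      refine lt_of_le_of_ne hp₁ fun h ↦ ?_
      have hd := hsmall (hidx t) (hγmem t) (h ▸ hE)
      linarith [dist_triangle E (γ t) x, dist_comm E (γ t)]
    have hstart' : r₂ < dist (leftPt D σ (p₂ + 1)) x := by
      have h := hsmall (p := p₂) (by have := hidx t; omega) hF (by rw [leftPiece_eq]; exact right_mem_segment _ _ _)
      linarith [dist_triangle F (leftPt D σ (p₂ + 1)) x, dist_comm F (leftPt D σ (p₂ + 1))]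
    have hend' : dist (leftPt D σ (p₁ - 1 + 1)) x < r₁ := by
      rw [show p₁ - 1 + 1 = p₁ by omega]
      have h := hsmall (p := p₁) (by have := hidx t; omega) (by rw [leftPiece_eq]; exact left_mem_segment _ _ _) hE
      linarith [dist_triangle (leftPt D σ p₁) E x]
    obtain ⟨p₁', p₂', E', F', T', hp₂', hp₂₁', hp₁', hE', hF', hEd', hFd', -, hsub', -, hlt₂', hgt₁'⟩ :=
      exists_tight_polyline' (leftPt D σ) x (ps := p₂ + 1) (pe := p₁ - 1) (by omega)
        (fun p h1 h2 ↦ hdiam hr' p (by omega) (by omega)) hstart' hend'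
    rw [← leftPiece_eq] at hE' hF'
    -- here `F'` (distance `r₂`) is on the earlier piece `p₂'`, `E'` (distance `r₁`) on the later piece `p₁'`
    refine assemble p₂ p₁ E F T p₂' p₁' F' E' T'.symm hps₂ (by omega) hp₂₁' (by omega) hp₁e hEd hFd
      (fun z hz ↦ by have := hsub hz; simpa only [leftPiece_eq] using this) htight
      (fun p h1 h2 ↦ ?_) (Or.inr ⟨hFd', hEd'⟩) hF' hE'
      (by rw [Path.symm_range]; exact fun z hz ↦ by have := hsub' hz; simpa only [leftPiece_eq] using this)
      (fun p h1 h2 z hz ↦ ⟨hgt₁' p h1.le h2 z (by rwa [leftPiece_eq] at hz), hlt₂' p h1 (by omega) z (by rwa [leftPiece_eq] at hz)⟩)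
    rw [hrange, leftPiece_eq]
    intro z hz
    exact Or.inl (Or.inr (mem_iUnion₂.2 ⟨p, Finset.mem_Ioo.2 ⟨h1, h2⟩, hz⟩))

/-- A lattice point lies in no open face. [folklore] -/
theorem toComplex_not_mem_openSq (v F : Site 2) : Site.toComplex v ∉ openSq F := by
  intro h
  obtain ⟨h1, h2⟩ := h 0
  rw [coordVec_toComplex] at h1 h2
  have a1 : F 0 < v 0 := by exact_mod_cast h1
  have a2 : v 0 < F 0 + 1 := by exact_mod_cast h2
  omega

/-- A lattice point is not the midpoint of a lattice edge. [folklore] -/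
theorem toComplex_ne_midpoint {v a b : Site 2} (hab : (zdGraph 2).Adj a b) :
    Site.toComplex v ≠ (Site.toComplex a + Site.toComplex b) / 2 := by
  intro h
  obtain ⟨i₀, hi₀⟩ := (zdGraph_adj_iff a b).1 hab
  have hmid : (Site.toComplex a + Site.toComplex b) / 2 = (1 / 2 : ℝ) • (Site.toComplex a + Site.toComplex b) := by
    rw [Complex.real_smul]; push_cast; ring
  have hc : coordVec (Site.toComplex v) i₀ = coordVec ((1 / 2 : ℝ) • (Site.toComplex a + Site.toComplex b)) i₀ := by
    rw [← hmid, ← h]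
  rw [coordVec_smul, coordVec_add, coordVec_toComplex, coordVec_toComplex, coordVec_toComplex] at hc
  rcases hi₀ with hi₀ | hi₀ <;> rw [hi₀, Pi.add_apply, Pi.single_eq_same] at hc <;> push_cast at hc
  · have h' : (2 * v i₀ : ℝ) = 2 * a i₀ + 1 := by linarith
    have : (2 * v i₀ : ℤ) = 2 * a i₀ + 1 := by exact_mod_cast h'
    omega
  · have h' : (2 * v i₀ : ℝ) = 2 * b i₀ + 1 := by linarith
    have : (2 * v i₀ : ℤ) = 2 * b i₀ + 1 := by exact_mod_cast h'
    omega

/-! ### The band of lattice levels: free sites, sources, targets, seeds next to the `+` arc -/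

section Band

open scoped Classical in
/-- The **free band sites**: interior sites of `Ω_δ` (carrying a free spin) with lattice level
about `x₀` in `[nᵢ, nₒ]`. [cite: KemppainenSmirnov2017, §3.2] -/
def spinBandSites (D : DiscreteDobrushin) (x₀ : Site 2) (nᵢ nₒ : ℤ) : Finset (Site 2) :=
  (zdInteriorFinset D).filter fun v ↦ nᵢ ≤ supLevel x₀ v ∧ supLevel x₀ v ≤ nₒ

open scoped Classical in
/-- The sources: free band sites of level `nᵢ`. [cite: KemppainenSmirnov2017, §3.2] -/
def spinBandIn (D : DiscreteDobrushin) (x₀ : Site 2) (nᵢ nₒ : ℤ) : Finset (Site 2) :=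
  (spinBandSites D x₀ nᵢ nₒ).filter fun v ↦ supLevel x₀ v = nᵢ

open scoped Classical in
/-- The targets: free band sites of level `nₒ`. [cite: KemppainenSmirnov2017, §3.2] -/
def spinBandOut (D : DiscreteDobrushin) (x₀ : Site 2) (nᵢ nₒ : ℤ) : Finset (Site 2) :=
  (spinBandSites D x₀ nᵢ nₒ).filter fun v ↦ supLevel x₀ v = nₒ

open scoped Classical in
/-- The seeds: free band sites lattice-adjacent to a site of the `+` arc `a_δ`. [cite: KemppainenSmirnov2017, §3.2] -/
def spinBandSeeds (D : DiscreteDobrushin) (x₀ : Site 2) (nᵢ nₒ : ℤ) : Finset (Site 2) :=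
  (spinBandSites D x₀ nᵢ nₒ).filter fun v ↦ ∃ y ∈ D.zdArcA, (zdGraph 2).Adj v y

/-- Membership in the free band sites. [folklore] -/
theorem mem_spinBandSites {x₀ : Site 2} {nᵢ nₒ : ℤ} {v : Site 2} :
    v ∈ spinBandSites D x₀ nᵢ nₒ ↔ v ∈ zdInteriorFinset D ∧ nᵢ ≤ supLevel x₀ v ∧ supLevel x₀ v ≤ nₒ := by
  classical
  rw [spinBandSites, Finset.mem_filter]

/-- Membership in the sources. [folklore] -/
theorem mem_spinBandIn {x₀ : Site 2} {nᵢ nₒ : ℤ} {v : Site 2} :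
    v ∈ spinBandIn D x₀ nᵢ nₒ ↔ v ∈ spinBandSites D x₀ nᵢ nₒ ∧ supLevel x₀ v = nᵢ := by
  classical
  rw [spinBandIn, Finset.mem_filter]

/-- Membership in the targets. [folklore] -/
theorem mem_spinBandOut {x₀ : Site 2} {nᵢ nₒ : ℤ} {v : Site 2} :
    v ∈ spinBandOut D x₀ nᵢ nₒ ↔ v ∈ spinBandSites D x₀ nᵢ nₒ ∧ supLevel x₀ v = nₒ := by
  classical
  rw [spinBandOut, Finset.mem_filter]

/-- Membership in the seeds. [folklore] -/
theorem mem_spinBandSeeds {x₀ : Site 2} {nᵢ nₒ : ℤ} {v : Site 2} :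
    v ∈ spinBandSeeds D x₀ nᵢ nₒ ↔ v ∈ spinBandSites D x₀ nᵢ nₒ ∧ ∃ y ∈ D.zdArcA, (zdGraph 2).Adj v y := by
  classical
  rw [spinBandSeeds, Finset.mem_filter]

end Band

/-! ### The sector argument: `2(j + N)` traversals give `j` separated local `+` arms avoiding the `+` arc -/

/-- **Separated `+` arms from traversals of the leftmost interface (spin Ising, one-sided).** Let
`(Ω_δ, a_δ, b_δ)` be admissible square-lattice Dobrushin data on a Jordan domain `D` with marked
boundary points, `σ` a spin configuration, and let the polygon of its leftmost Dobrushin interface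
traverse the shell `D(x; ρ, R)` `2(j + N)` times, `N = ⌊1/θ⌋₊ + 1`, where `θ` is a modulus of
`ρ`-continuity of the boundary parametrisation and `ρ + 5δ < q₁`, `q₁ + ρ + 7δ ≤ r₁`,
`r₁ + 40δ ≤ r₂`, `r₂ + ρ + 7δ ≤ q₂`, `q₂ + 5δ < R`. Let `nᵢ < nₒ` be lattice levels about `x₀`
whose band lies inside `{r₁ + 5δ ≤ |· - x| ≤ r₂ - 5δ}`, with `{|· - x| ≤ r₁ + 4δ}` below level `nᵢ`
and `{|· - x| ≥ r₂ - 4δ}` above level `nₒ`. Then `σ` has `j` local `+` paths of free band sites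
from level `nᵢ` to level `nₒ` lying in pairwise distinct local `+` clusters of the free band sites,
none of them locally `+`-connected to a free band site adjacent to the `+` arc
(`plusArmsAvoiding`). Proof: the sector argument of Aizenman–Burchard (App. A, Lemma A.5) with
the cut set of the leftmost interface: tight arcs of distinct traversals are disjoint, a sector
(component of the annulus minus the cut set) is the left sector of at most two traversals
(three-arcs lemma), at most `N` sectors are tainted by a boundary point in the middle of the
annulus, and an untainted sector contains the `+` left chain of its traversal inside the free
band; local `+` paths of the band never leave a sector, and a `+` path reaching a neighbour of
the `+` arc would taint the sector. [cite: AizenmanBurchardDuke1999, Appendix A, Lemma A.5] -/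
theorem plusArmsAvoiding_of_hasTraversals {Dm : RandomPlanarGeometry.DobrushinDomain} (hΩ : D.Ω = Dm.carrier)
    (hD : D.IsZdAdmissible) (σ : SpinConfig (Site 2))
    {x : ℂ} {ρ R q₁ q₂ r₁ r₂ : ℝ} (hq₁pos : 0 < q₁) (hρ : 0 ≤ ρ)
    (hq₁ : ρ + 5 * D.δ < q₁) (hq₂ : q₂ + 5 * D.δ < R) (hr₁ : q₁ + ρ + 7 * D.δ ≤ r₁) (hr₂ : r₂ + ρ + 7 * D.δ ≤ q₂)
    (hr : r₁ + 40 * D.δ ≤ r₂)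
    {θ : ℝ} (hθ : 0 < θ) (hmod : ∀ s t : ℝ, |s - t| < θ → dist (Dm.boundary s) (Dm.boundary t) < ρ)
    (x₀ : Site 2) {nᵢ nₒ : ℤ} (hnio : nᵢ < nₒ)
    (hband : ∀ z : Site 2, nᵢ ≤ supLevel x₀ z → supLevel x₀ z ≤ nₒ →
      r₁ + 5 * D.δ ≤ dist (meshPoint D.δ z) x ∧ dist (meshPoint D.δ z) x ≤ r₂ - 5 * D.δ)
    (hin : ∀ z : Site 2, dist (meshPoint D.δ z) x ≤ r₁ + 4 * D.δ → supLevel x₀ z < nᵢ)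
    (hout : ∀ z : Site 2, r₂ - 4 * D.δ ≤ dist (meshPoint D.δ z) x → nₒ < supLevel x₀ z)
    {j : ℕ} (htr : (spinPolygon D.δ (leftmostInterface D σ)).HasTraversals (2 * (j + (⌊1 / θ⌋₊ + 1))) x ρ R) :
    σ ∈ plusArmsAvoiding (zdGraph 2) (spinBandSites D x₀ nᵢ nₒ) (spinBandIn D x₀ nᵢ nₒ)
      (spinBandOut D x₀ nᵢ nₒ) (spinBandSeeds D x₀ nᵢ nₒ) j := by
  classical
  have hδ := hD.delta_pos
  have hNlen := one_le_leftLength hD σ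
  set Gd := discreteDomainGraph D.Ω D.δ with hGd
  set N := ⌊1 / θ⌋₊ + 1 with hN
  set k := 2 * (j + N) with hk
  set 𝔸 : Set ℂ := {z | q₁ < dist z x ∧ dist z x < q₂} with h𝔸
  set X : Set ℂ := 𝔸 \ leftCut D σ with hX
  have hq : q₁ < q₂ := by linarith
  obtain ⟨sT, tT, htrav, hsep⟩ := htr
  /- per-traversal data -/
  choose pl ph E F T m i' j' hpl hplh hph h1pl hphN hEd hFd hTsub hTcut hTtight hmT hi'm hmj' hpli' hj'ph hchain hinnerp hcends
    using fun q : Fin k ↦ exists_traversal_arc_left hD σ hq₁ hq₂ (by linarith) (by linarith) hr (htrav q)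
  -- neighbourhoods of the chain sites lie in the open annulus
  have hball : ∀ q i, i' q ≤ i → i ≤ j' q → closedBall (meshPoint D.δ (leftSite D σ i)) (4 * D.δ) ⊆ 𝔸 := by
    intro q i h1 h2 z hz
    rw [mem_closedBall] at hz
    obtain ⟨hlo, hhi⟩ := hchain q i h1 h2
    constructor
    · linarith [dist_triangle (meshPoint D.δ (leftSite D σ i)) z x, dist_comm z (meshPoint D.δ (leftSite D σ i))]
    · linarith [dist_triangle z (meshPoint D.δ (leftSite D σ i)) x]
  /- `+` edges of `Ω_δ` inside the annulus keep the component of `X` -/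
  have hstep : ∀ {u w : Site 2}, (zdGraph 2).Adj u w → D.IsPlus σ u → D.IsPlus σ w → closedBall (meshPoint D.δ u) D.δ ⊆ 𝔸 →
      connectedComponentIn X (meshPoint D.δ u) = connectedComponentIn X (meshPoint D.δ w) := by
    intro u w hzd hu hw hA
    have hseg : segment ℝ (meshPoint D.δ u) (meshPoint D.δ w) ⊆ X := by
      intro z hz
      refine ⟨hA ?_, fun hzK ↦ Set.disjoint_left.1 (segment_disjoint_leftCut_of_isPlus hD σ hzd hu hw) hz hzK⟩
      have hd : dist (meshPoint D.δ w) (meshPoint D.δ u) ≤ D.δ := by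
        rw [dist_comm, dist_meshPoint_of_adj hzd, abs_of_pos hδ]
      exact (convex_closedBall _ _).segment_subset (mem_closedBall.2 (by rw [dist_self]; exact hδ.le))
        (mem_closedBall.2 hd) hz
    exact connectedComponentIn_eq ((convex_segment _ _).isPreconnected.subset_connectedComponentIn
      (left_mem_segment _ _ _) hseg (right_mem_segment _ _ _))
  /- the left sectors -/
  set comp : Fin k → Set ℂ := fun q ↦ connectedComponentIn X (meshPoint D.δ (leftSite D σ (m q))) with hcompdef
  have hcompsub : ∀ q, comp q ⊆ X := fun q ↦ connectedComponentIn_subset _ _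
  -- corners of the faces of the chain are close to the chain sites
  have hcorner : ∀ q i, i' q ≤ i → i < j' q → ∀ v, IsCorner v (leftOrbit D σ (i + 1)) →
      dist (meshPoint D.δ v) (meshPoint D.δ (leftSite D σ i)) ≤ 2 * D.δ := by
    intro q i h1 h2 v hv
    have hc := (isCorner_leftSite hD σ (k := i) (by have := hphN q; have := hj'ph q; omega)).2
    have h := closedSq_subset_closedBall hv (toComplex_mem_closedSq hc)
    rw [mem_closedBall] at h
    rw [meshPoint_eq_smul, meshPoint_eq_smul, dist_smul₀, Real.norm_eq_abs, abs_of_pos hδ, dist_comm]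
    nlinarith
  -- along a `+` walk through corners of a chain face the component is constant
  have hwalk : ∀ q i, i' q ≤ i → i < j' q → ∀ (a b : Site 2) (w : Gd.Walk a b),
      (∀ v ∈ w.support, D.IsPlus σ v ∧ IsCorner v (leftOrbit D σ (i + 1))) →
      connectedComponentIn X (meshPoint D.δ a) = connectedComponentIn X (meshPoint D.δ b) := by
    intro q i h1 h2 a b w
    induction w with
    | nil => intro; rfl
    | @cons a b _ hab w' ih =>
      intro hsupp
      have ha := hsupp a (by simp)
      have hb := hsupp b (by simp)
      rw [hstep (meshGraph_le_zdGraph _ _ (discreteDomainGraph_le_meshGraph _ _ hab)) ha.1 hb.1 ?_]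
      · exact ih fun v hv ↦ hsupp v (by simp [hv])
      · refine (closedBall_subset_closedBall' ?_).trans (hball q i h1 h2.le)
        linarith [hcorner q i h1 h2 a ha.2]
  -- the chain sites of a traversal lie in its sector
  have hcvcomp : ∀ q i, i' q ≤ i → i ≤ j' q → meshPoint D.δ (leftSite D σ i) ∈ comp q := by
    intro q
    -- consecutive chain sites have the same component
    have hsucc : ∀ i, i' q ≤ i → i < j' q →
        connectedComponentIn X (meshPoint D.δ (leftSite D σ i)) = connectedComponentIn X (meshPoint D.δ (leftSite D σ (i + 1))) := by
      intro i h1 h2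
      obtain ⟨p, -, hp⟩ := exists_walk_leftSite_succ hD σ (k := i) (by have := hphN q; have := hj'ph q; omega)
      exact hwalk q i h1 h2 _ _ p hp
    have hfrom : ∀ d, i' q + d ≤ j' q →
        connectedComponentIn X (meshPoint D.δ (leftSite D σ (i' q))) = connectedComponentIn X (meshPoint D.δ (leftSite D σ (i' q + d))) := by
      intro d
      induction d with
      | zero => intro; rfl
      | succ d ih =>
        intro hd
        rw [ih (by omega), hsucc (i' q + d) (by omega) (by omega), Nat.add_assoc]
    have hall : ∀ i, i' q ≤ i → i ≤ j' q →
        connectedComponentIn X (meshPoint D.δ (leftSite D σ i)) = connectedComponentIn X (meshPoint D.δ (leftSite D σ (i' q))) := by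
      intro i h1 h2
      have := hfrom (i - i' q) (by omega)
      rw [show i' q + (i - i' q) = i by omega] at this
      exact this.symm
    intro i h1 h2
    have hmem : meshPoint D.δ (leftSite D σ i) ∈ X := by
      refine ⟨hball q i h1 h2 (mem_closedBall_self (by positivity)), fun hK ↦ ?_⟩
      -- a lattice point is not on the cut set (inner points of faces and midpoints of edges)
      obtain ⟨k', -, hk', hz⟩ := mem_leftCut_iff.1 hK
      have hz' := (mem_leftPiece_iff hδ.ne').1 hz
      rw [meshPoint_eq_smul, inv_smul_smul₀ hδ.ne'] at hz'
      rcases eq_leftVert_of_not_mem_openSq hD σ (by omega) hz' (toComplex_not_mem_openSq _ _) with he | he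
      · rw [leftVert_eq_midpoint hD σ (k := k') (by omega)] at he
        exact toComplex_ne_midpoint (meshGraph_le_zdGraph _ _ (discreteDomainGraph_le_meshGraph _ _
          (adj_leftSite_dualDartRight hD σ (k := k') (by omega)))) he
      · rw [leftVert_eq_midpoint hD σ (k := k' + 1) (by omega)] at he
        exact toComplex_ne_midpoint (meshGraph_le_zdGraph _ _ (discreteDomainGraph_le_meshGraph _ _
          (adj_leftSite_dualDartRight hD σ (k := k' + 1) (by omega)))) he
    change meshPoint D.δ (leftSite D σ i) ∈ connectedComponentIn X (meshPoint D.δ (leftSite D σ (m q)))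
    rw [hall (m q) (hi'm q) (hmj' q), ← hall i h1 h2]
    exact mem_connectedComponentIn hmem
  have hcompne : ∀ q, (comp q).Nonempty := fun q ↦ ⟨_, hcvcomp q (m q) (hi'm q) (hmj' q)⟩
  -- the touching points: the polygon vertex `leftPt (m q)` at the end of the half-edge from the chain site `m q`
  have htouch : ∀ q, (closure (comp q) ∩ range (T q) ∩ 𝔸).Nonempty := by
    intro q
    have hmN2 : m q + 2 ≤ leftLength D σ := by have := hphN q; have := hj'ph q; have := hmj' q; omega
    have hmN : m q ≤ leftLength D σ := by omega
    set P := leftPt D σ (m q) with hP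
    have hPpiece : P ∈ leftPiece D σ (m q) := by rw [leftPiece_eq]; exact left_mem_segment _ _ _
    set c := meshPoint D.δ (leftSite D σ (m q)) with hc
    have hPc : dist c P ≤ 2 * D.δ := (dist_leftSite_le_of_mem_leftPiece hD σ (by omega) hPpiece).1
    have hballm := hball q (m q) (hi'm q) (hmj' q)
    -- the half-open segment `[c, P)` lies in `X`
    set f : ℝ → ℂ := fun t ↦ AffineMap.lineMap c P t with hf
    have hfcont : Continuous f := AffineMap.lineMap_continuous
    have hfseg : ∀ t ∈ Icc (0 : ℝ) 1, f t ∈ segment ℝ c P := fun t ht ↦ by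
      rw [segment_eq_image_lineMap]; exact ⟨t, ht, rfl⟩
    have hsegA : segment ℝ c P ⊆ 𝔸 := fun z hz ↦ hballm ((convex_closedBall _ _).segment_subset
      (mem_closedBall_self (by positivity)) (mem_closedBall.2 (by rw [dist_comm]; linarith)) hz)
    have hPmid : P = (meshPoint D.δ (leftSite D σ (m q)) + meshPoint D.δ (dualDartRight (leftOrbit D σ (m q)) (leftOrbit D σ (m q + 1)))) / 2 := by
      rw [hP, leftPt_eq, leftVert_eq_midpoint hD σ hmN, meshPoint, meshPoint]; unfold leftSite; ring
    have hsegedge : segment ℝ c P ⊆ segment ℝ (meshPoint D.δ (leftSite D σ (m q)))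
        (meshPoint D.δ (dualDartRight (leftOrbit D σ (m q)) (leftOrbit D σ (m q + 1)))) := by
      refine (convex_segment _ _).segment_subset (left_mem_segment _ _ _) ?_
      rw [hPmid]
      exact ⟨1 / 2, 1 / 2, by norm_num, by norm_num, by norm_num, by simp only [Complex.real_smul]; push_cast; ring⟩
    have hoff : ∀ z ∈ segment ℝ c P, z ≠ P → z ∉ leftCut D σ := by
      intro z hz hzP hzK
      obtain ⟨k', -, hk', hzk'⟩ := mem_leftCut_iff.1 hzK
      have hzd : (zdGraph 2).Adj (leftSite D σ (m q)) (dualDartRight (leftOrbit D σ (m q)) (leftOrbit D σ (m q + 1))) :=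
        meshGraph_le_zdGraph _ _ (discreteDomainGraph_le_meshGraph _ _ (adj_leftSite_dualDartRight hD σ hmN))
      obtain ⟨m', hm', he, hzv⟩ := crossedEdge_of_mem_leftPiece_of_mem_segment hD σ (by omega) hzd hzk' (hsegedge hz)
      apply hzP
      -- the crossed edges `m q` and `m'` coincide, so `z` is the midpoint `P`
      have hsum : Site.toComplex (leftSite D σ m') + Site.toComplex (dualDartRight (leftOrbit D σ m') (leftOrbit D σ (m' + 1))) =
          Site.toComplex (leftSite D σ (m q)) + Site.toComplex (dualDartRight (leftOrbit D σ (m q)) (leftOrbit D σ (m q + 1))) := by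
        rcases Sym2.eq_iff.1 he with ⟨h1, h2⟩ | ⟨h1, h2⟩
        · rw [← h1, ← h2]
        · rw [← h1, ← h2, add_comm]
      have hm'N : m' ≤ leftLength D σ := by rcases hm' with rfl | rfl <;> omega
      have hzv' : D.δ⁻¹ • z = (Site.toComplex (leftSite D σ (m q)) +
          Site.toComplex (dualDartRight (leftOrbit D σ (m q)) (leftOrbit D σ (m q + 1)))) / 2 := by
        rw [hzv, leftVert_eq_midpoint hD σ hm'N, hsum]
      rw [← smul_inv_smul₀ hδ.ne' z, hzv', hPmid, meshPoint, meshPoint, Complex.real_smul]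
      unfold leftSite; ring
    have hIco : f '' Ico (0 : ℝ) 1 ⊆ X := by
      rintro _ ⟨t, ht, rfl⟩
      have hseg := hfseg t (Ico_subset_Icc_self ht)
      refine ⟨hsegA hseg, hoff _ hseg fun hEq ↦ ?_⟩
      -- `f t = P = f 1` with `t < 1` contradicts injectivity of the parametrisation (`c ≠ P`)
      have hcP : c ≠ P := by
        intro hcP'
        have h1 : Site.toComplex (leftSite D σ (m q)) = leftVert D σ (m q) := by
          have h2 := hcP'
          rw [hc, hP, leftPt_eq, meshPoint] at h2
          exact mul_left_cancel₀ (Complex.ofReal_ne_zero.2 hδ.ne') h2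
        rw [leftVert_eq_midpoint hD σ hmN] at h1
        exact toComplex_ne_midpoint (meshGraph_le_zdGraph _ _ (discreteDomainGraph_le_meshGraph _ _
          (adj_leftSite_dualDartRight hD σ hmN))) h1
      have h1 : f 1 = P := by simp [hf]
      have hinj : Function.Injective f := fun a b hab ↦ by
        simp only [hf, AffineMap.lineMap_apply_module] at hab
        have : (a - b) • (P - c) = 0 := by rw [sub_smul]; linear_combination (norm := module) hab
        rcases smul_eq_zero.1 this with h | h
        · linarith
        · exact absurd (sub_eq_zero.1 h).symm hcP
      have := hinj (hEq.trans h1.symm)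
      exact absurd this (ne_of_lt ht.2)
    have hc0 : f 0 = c := by simp [hf]
    have hsub : f '' Ico (0 : ℝ) 1 ⊆ comp q := by
      have hpre : IsPreconnected (f '' Ico (0 : ℝ) 1) := isPreconnected_Ico.image f hfcont.continuousOn
      exact hpre.subset_connectedComponentIn (x := c) ⟨0, ⟨le_rfl, zero_lt_one⟩, hc0⟩ hIco
    have hPcl : P ∈ closure (comp q) := by
      refine closure_mono hsub ?_
      have : P ∈ f '' closure (Ico (0 : ℝ) 1) := ⟨1, by rw [closure_Ico zero_ne_one]; exact ⟨zero_le_one, le_rfl⟩, by simp [hf]⟩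
      exact image_closure_subset_closure_image hfcont this
    exact ⟨P, ⟨hPcl, hmT q hPpiece⟩, hsegA (right_mem_segment _ _ _)⟩
  /- the arcs are pairwise disjoint -/
  have hdisj_lt : ∀ q q', q < q' → Disjoint (range (T q)) (range (T q')) := by
    intro q q' hqq'
    refine Set.disjoint_left.2 fun z hz hz' ↦ ?_
    obtain ⟨p, hp, hzp⟩ := mem_iUnion₂.1 (hTsub q hz)
    obtain ⟨p', hp', hzp'⟩ := mem_iUnion₂.1 (hTsub q' hz')
    rw [Finset.mem_Icc] at hp hp'
    have hts : lIdx D σ (tT q) ≤ lIdx D σ (sT q') := lIdx_mono σ (hsep hqq').le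
    have hfar : p + 2 ≤ p' := by have := hph q; have := hpl q'; omega
    have hd := leftChord_disjoint hD σ hfar (by have := hphN q'; omega)
    rw [mem_leftPiece_iff hδ.ne'] at hzp hzp'
    exact Set.disjoint_left.1 hd hzp hzp'
  have hdisj : ∀ q q', q ≠ q' → Disjoint (range (T q)) (range (T q')) := by
    intro q q' hqq'
    rcases lt_or_gt_of_ne hqq' with h | h
    · exact hdisj_lt q q' h
    · exact (hdisj_lt q' q h).symm
  /- no sector is the left sector of three traversals -/
  have hfib : ∀ a₁ a₂ a₃ : Fin k, a₁ ≠ a₂ → a₂ ≠ a₃ → a₃ ≠ a₁ → comp a₁ = comp a₂ → comp a₂ = comp a₃ → False := by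
    intro a₁ a₂ a₃ h12 h23 h31 e12 e23
    refine not_three_arcs_touch hq₁pos hq T hEd hFd (fun q u ↦ ⟨(hTtight q _ ⟨u, rfl⟩).1, (hTtight q _ ⟨u, rfl⟩).2.1⟩)
      (fun q u hu ↦ (hTtight q _ ⟨u, rfl⟩).2.2.1 hu) (fun q u hu ↦ (hTtight q _ ⟨u, rfl⟩).2.2.2 hu) hdisj
      (S := comp a₁) isPreconnected_connectedComponentIn (fun z hz ↦ (hcompsub a₁ hz).1)
      (fun q ↦ Set.disjoint_left.2 fun z hz hz' ↦ (hcompsub a₁ hz).2 (hTcut q hz')) h12 h23 h31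
      (htouch a₁) ?_ ?_
    · rw [e12]; exact htouch a₂
    · rw [e12, e23]; exact htouch a₃
  /- counting: at least `j + N` distinct sectors -/
  set Fc : Finset (Set ℂ) := Finset.univ.image comp with hFc
  have hcard : k ≤ 2 * Fc.card := by
    have h := Finset.card_le_mul_card_image (Finset.univ : Finset (Fin k)) (f := comp) 2 ?_
    · simpa using h
    intro y hy
    by_contra hgt
    push Not at hgt
    obtain ⟨l₁, hl₁, l₂, hl₂, l₃, hl₃, h12, h13, h23⟩ := Finset.two_lt_card.1 hgt
    simp only [Finset.mem_filter, Finset.mem_univ, true_and] at hl₁ hl₂ hl₃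
    exact hfib l₁ l₂ l₃ h12 h23 (Ne.symm h13) (hl₁.trans hl₂.symm) (hl₂.trans hl₃.symm)
  /- tainted sectors are at most `N` -/
  set tainted : Set ℂ → Prop := fun C ↦ ∃ z ∈ frontier Dm.carrier, z ∈ C ∧ q₁ + ρ ≤ dist z x ∧ dist z x ≤ q₂ - ρ
    with htainted
  have hXeq : (ball x q₂ \ closedBall x q₁) \ leftCut D σ = X := by
    ext z
    simp only [hX, h𝔸, Set.mem_sdiff, mem_ball, mem_closedBall, not_le, mem_setOf_eq]
    tauto
  have htaint_card : (Fc.filter fun C ↦ tainted C).card ≤ N := by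
    set TF := Fc.filter fun C ↦ tainted C with hTF
    have hwit : ∀ C : TF, ∃ z ∈ frontier Dm.carrier, z ∈ (C : Set ℂ) ∧ q₁ + ρ ≤ dist z x ∧ dist z x ≤ q₂ - ρ := by
      intro C
      have := (Finset.mem_filter.1 C.2).2
      exact this
    choose zf hzfr hzC hzlo hzhi using hwit
    have hcompC : ∀ C : TF, ∃ q, comp q = C := fun C ↦ by
      obtain ⟨q, -, hq'⟩ := Finset.mem_image.1 (Finset.mem_filter.1 C.2).1
      exact ⟨q, hq'⟩
    have hccz : ∀ C : TF, connectedComponentIn X (zf C) = C := by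
      intro C
      obtain ⟨q, hq'⟩ := hcompC C
      have hz := hzC C
      rw [← hq'] at hz ⊢
      exact (connectedComponentIn_eq hz).symm
    set S : Finset ℂ := Finset.univ.image zf with hS
    have hinj : Function.Injective zf := by
      intro C C' h
      apply Subtype.ext
      have h1 := hccz C; have h2 := hccz C'
      rw [h] at h1
      exact h1.symm.trans h2
    have hScard : S.card = TF.card := by
      rw [hS, Finset.card_image_of_injective _ hinj, Finset.card_univ, Fintype.card_coe]
    rw [← hScard]
    refine card_le_of_separated_frontier_points Dm.toJordanDomain (x := x) (r₁ := q₁) (r₂ := q₂) (η := ρ) hθ hmod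
      (K := leftCut D σ) (leftCut_disjoint_frontier hΩ hD σ) S (fun z hz ↦ ?_) (fun z hz z' hz' hzz' ↦ ?_)
    · obtain ⟨C, -, rfl⟩ := Finset.mem_image.1 hz
      exact ⟨hzfr C, hzlo C, hzhi C⟩
    · obtain ⟨C, -, rfl⟩ := Finset.mem_image.1 hz
      obtain ⟨C', -, rfl⟩ := Finset.mem_image.1 hz'
      rw [hXeq, hccz, hccz]
      intro h
      apply hzz'
      rw [Subtype.ext h]
  /- untainted distinct sectors: at least `j` -/
  set G : Finset (Set ℂ) := Fc.filter fun C ↦ ¬ tainted C with hG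
  have hjG : j ≤ G.card := by
    have h1 : Fc.card = (Fc.filter fun C ↦ tainted C).card + G.card := by
      rw [hG, Finset.card_filter_add_card_filter_not]
    omega
  obtain ⟨Cs, hCsinj, hCsG⟩ := exists_injective_of_le_card hjG
  have hCs : ∀ i, ∃ q, comp q = Cs i := fun i ↦ by
    obtain ⟨q, -, hq'⟩ := Finset.mem_image.1 (Finset.mem_filter.1 (hCsG i)).1
    exact ⟨q, hq'⟩
  choose L hL using hCs
  have hLne : ∀ i i', i ≠ i' → comp (L i) ≠ comp (L i') := by
    intro i i' hii' h
    rw [hL, hL] at h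
    exact hii' (hCsinj h)
  have huntaint : ∀ i, ¬ tainted (comp (L i)) := fun i ↦ by
    have := (Finset.mem_filter.1 (hCsG i)).2
    rwa [← hL] at this
  /- boundary sites in the middle of the annulus taint their sector -/
  have hsegA : ∀ {c : ℂ} {z : ℂ}, r₁ - 5 * D.δ < dist c x → dist c x < r₂ + 5 * D.δ → dist z c ≤ 2 * D.δ →
      segment ℝ c z ⊆ 𝔸 ∧ q₁ + ρ ≤ dist z x ∧ dist z x ≤ q₂ - ρ := by
    intro c z hlo hhi hzc
    refine ⟨fun w hw ↦ ?_, ?_, ?_⟩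
    · have hw' : dist w c ≤ 2 * D.δ := by
        have := (convex_closedBall c (2 * D.δ)).segment_subset (mem_closedBall.2 (by rw [dist_self]; positivity))
          (mem_closedBall.2 hzc) hw
        rwa [mem_closedBall] at this
      constructor
      · linarith [dist_triangle c w x, dist_comm c w]
      · linarith [dist_triangle w c x]
    · linarith [dist_triangle c z x, dist_comm c z]
    · linarith [dist_triangle z c x]
  have htaint_of_bdry : ∀ i₀ (v : Site 2), v ∈ D.zdBoundary →
      r₁ - 5 * D.δ < dist (meshPoint D.δ v) x → dist (meshPoint D.δ v) x < r₂ + 5 * D.δ →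
      connectedComponentIn X (meshPoint D.δ v) = comp (L i₀) → False := by
    intro i₀ v hv hlo hhi hcc
    apply huntaint i₀
    obtain ⟨z, hzfr, hzd, hfree⟩ := exists_frontier_near_of_mem_zdBoundary_leftCut hΩ hD σ hv
    obtain ⟨hsegsub, hz1, hz2⟩ := hsegA hlo hhi hzd
    simp only [htainted]
    refine ⟨z, hzfr, ?_, hz1, hz2⟩
    rw [← hcc]
    exact (convex_segment _ _).isPreconnected.subset_connectedComponentIn (left_mem_segment _ _ _)
      (fun w hw ↦ (⟨hsegsub hw, hfree w hw⟩ : w ∈ 𝔸 \ leftCut D σ)) (right_mem_segment _ _ _)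
  /- the chain graph of a traversal and the arm in the band -/
  have hinterior : ∀ v : Site 2, v ∈ meshDomain D.Ω D.δ → v ∉ D.zdBoundary → v ∈ zdInteriorFinset D := by
    intro v h1 h2
    rw [← Finset.mem_coe, coe_zdInteriorFinset hD.isBounded hδ]
    exact ⟨h1, h2⟩
  have hplus_one : ∀ v : Site 2, v ∉ D.zdBoundary → D.IsPlus σ v → σ v = 1 := by
    intro v hv hp
    rcases hp with h | ⟨-, h⟩
    · exact absurd (D.zdArcA_subset_zdBoundary h) hv
    · exact h
  have hccL : ∀ q i, i' q ≤ i → i ≤ j' q → connectedComponentIn X (meshPoint D.δ (leftSite D σ i)) = comp q :=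
    fun q i h1 h2 ↦ (connectedComponentIn_eq (hcvcomp q i h1 h2)).symm
  -- free band sites from interior `+` sites of the band
  have hfree : ∀ i₀ (v : Site 2), v ∈ meshDomain D.Ω D.δ → D.IsPlus σ v → nᵢ ≤ supLevel x₀ v → supLevel x₀ v ≤ nₒ →
      connectedComponentIn X (meshPoint D.δ v) = comp (L i₀) → v ∈ spinBandSites D x₀ nᵢ nₒ ∧ σ v = 1 := by
    intro i₀ v hvD hplus h1 h2 hcc
    obtain ⟨hlo, hhi⟩ := hband v h1 h2
    have hvb : v ∉ D.zdBoundary := fun hvb ↦ htaint_of_bdry i₀ v hvb (by linarith) (by linarith) hcc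
    exact ⟨mem_spinBandSites.2 ⟨hinterior v hvD hvb, h1, h2⟩, hplus_one v hvb hplus⟩
  have hA𝔸 : ∀ z : Site 2, nᵢ ≤ supLevel x₀ z → supLevel x₀ z ≤ nₒ → closedBall (meshPoint D.δ z) D.δ ⊆ 𝔸 := by
    intro z h1 h2 w hw
    rw [mem_closedBall] at hw
    obtain ⟨hlo, hhi⟩ := hband z h1 h2
    constructor
    · linarith [dist_triangle (meshPoint D.δ z) w x, dist_comm w (meshPoint D.δ z)]
    · linarith [dist_triangle w (meshPoint D.δ z) x]
  have harm : ∀ i₀ : Fin j, ∃ u : Site 2, u ∈ spinBandIn D x₀ nᵢ nₒ ∧ u ∈ spinBandSites D x₀ nᵢ nₒ ∧ σ u = 1 ∧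
      connectedComponentIn X (meshPoint D.δ u) = comp (L i₀) ∧
      ∃ w ∈ spinBandOut D x₀ nᵢ nₒ, (plusGraph (zdGraph 2) (spinBandSites D x₀ nᵢ nₒ) σ).Reachable u w := by
    intro i₀
    set q := L i₀ with hqdef
    -- the chain graph: `+` edges of `Ω_δ` between corners of the faces of the chain, inside the sector
    set H : SimpleGraph (Site 2) := SimpleGraph.fromRel fun u w ↦ Gd.Adj u w ∧ D.IsPlus σ u ∧ D.IsPlus σ w ∧
      connectedComponentIn X (meshPoint D.δ u) = comp q ∧ connectedComponentIn X (meshPoint D.δ w) = comp q ∧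
      ∃ i, i' q ≤ i ∧ i < j' q ∧ IsCorner u (leftOrbit D σ (i + 1)) ∧ IsCorner w (leftOrbit D σ (i + 1)) with hH
    have hHadj : ∀ {u w}, H.Adj u w → Gd.Adj u w ∧ D.IsPlus σ u ∧ D.IsPlus σ w ∧
        connectedComponentIn X (meshPoint D.δ u) = comp q ∧ connectedComponentIn X (meshPoint D.δ w) = comp q ∧
        ∃ i, i' q ≤ i ∧ i < j' q ∧ IsCorner u (leftOrbit D σ (i + 1)) ∧ IsCorner w (leftOrbit D σ (i + 1)) := by
      intro u w huw
      rw [hH, SimpleGraph.fromRel_adj] at huw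
      rcases huw.2 with ⟨h1, h2, h3, h4, h5, i, h6, h7, h8, h9⟩ | ⟨h1, h2, h3, h4, h5, i, h6, h7, h8, h9⟩
      · exact ⟨h1, h2, h3, h4, h5, i, h6, h7, h8, h9⟩
      · exact ⟨h1.symm, h3, h2, h5, h4, i, h6, h7, h9, h8⟩
    -- the chain is connected in `H`
    have hsuccH : ∀ i, i' q ≤ i → i < j' q → H.Reachable (leftSite D σ i) (leftSite D σ (i + 1)) := by
      intro i h1 h2
      obtain ⟨p, -, hp⟩ := exists_walk_leftSite_succ hD σ (k := i) (by have := hphN q; have := hj'ph q; omega)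
      have hLcc := hccL q (i + 1) (by omega) (by omega)
      suffices hw : ∀ (a b : Site 2) (w : Gd.Walk a b),
          (∀ v ∈ w.support, D.IsPlus σ v ∧ IsCorner v (leftOrbit D σ (i + 1))) →
          connectedComponentIn X (meshPoint D.δ b) = comp q → H.Reachable a b from hw _ _ p hp hLcc
      intro a b w
      induction w with
      | nil => intro _ _; rfl
      | @cons a b _ hab w' ih =>
        intro hsupp hbcc
        have ha := hsupp a (by simp)
        have hb := hsupp b (by simp)
        have hsupp' : ∀ v ∈ w'.support, D.IsPlus σ v ∧ IsCorner v (leftOrbit D σ (i + 1)) := fun v hv ↦ hsupp v (by simp [hv])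
        refine (SimpleGraph.Adj.reachable ?_).trans (ih hsupp' hbcc)
        rw [hH, SimpleGraph.fromRel_adj]
        refine ⟨hab.ne, Or.inl ⟨hab, ha.1, hb.1, ?_, ?_, i, h1, h2, ha.2, hb.2⟩⟩
        · rw [hwalk q i h1 h2 a _ (SimpleGraph.Walk.cons hab w') hsupp, hbcc]
        · rw [hwalk q i h1 h2 b _ w' hsupp', hbcc]
    have hreach : ∀ d, i' q + d ≤ j' q → H.Reachable (leftSite D σ (i' q)) (leftSite D σ (i' q + d)) := by
      intro d
      induction d with
      | zero => intro; rfl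
      | succ d ih =>
        intro hd
        exact (ih (by omega)).trans (hsuccH (i' q + d) (by omega) (by omega))
    have hreach' : H.Reachable (leftSite D σ (i' q)) (leftSite D σ (j' q)) := by
      have := hreach (j' q - i' q) (by have := hi'm q; have := hmj' q; omega)
      rwa [show i' q + (j' q - i' q) = j' q by have := hi'm q; have := hmj' q; omega] at this
    have hlip : ∀ ⦃u w : Site 2⦄, H.Adj u w → supLevel x₀ u ≤ supLevel x₀ w + 1 := fun u w huw ↦
      supLevel_le_of_adj x₀ (meshGraph_le_zdGraph _ _ (discreteDomainGraph_le_meshGraph _ _ (hHadj huw).1))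
    -- the band walk, in either direction of the chain
    have hband_walk : ∃ u v : Site 2, supLevel x₀ u = nᵢ ∧ supLevel x₀ v = nₒ ∧
        (SimpleGraph.fromRel fun s t ↦ H.Adj s t ∧ nᵢ ≤ supLevel x₀ s ∧ supLevel x₀ s ≤ nₒ ∧
          nᵢ ≤ supLevel x₀ t ∧ supLevel x₀ t ≤ nₒ).Reachable u v := by
      rcases hcends q with ⟨h1, h2⟩ | ⟨h1, h2⟩
      · obtain ⟨u, v, hu, hv, h⟩ := exists_walk_in_band (supLevel x₀) hlip hnio.le (hin _ (by linarith)).le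
          (hout _ (by linarith)).le hreach'
        exact ⟨u, v, hu, hv, h⟩
      · obtain ⟨u, v, hu, hv, h⟩ := exists_walk_in_band (supLevel x₀) hlip hnio.le (hin _ (by linarith)).le
          (hout _ (by linarith)).le hreach'.symm
        exact ⟨u, v, hu, hv, h⟩
    obtain ⟨u, v, hu, hv, huv⟩ := hband_walk
    -- `u ≠ v`, so `u` has a neighbour in `H`
    have hne : u ≠ v := fun h ↦ by rw [h, hv] at hu; omega
    obtain ⟨pth⟩ := huv
    have hfirst : ∃ w, H.Adj u w := by
      cases pth with
      | nil => exact absurd rfl hne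
      | cons h _ => exact ⟨_, ((SimpleGraph.fromRel_adj _ _ _).1 h).2.elim (fun h ↦ h.1) (fun h ↦ h.1.symm)⟩
    obtain ⟨w₀, hw₀⟩ := hfirst
    obtain ⟨hadj₀, hplus₀, -, hcc₀, -⟩ := hHadj hw₀
    -- band sites with an `H`-edge are free band sites with spin `+1`
    have hvert : ∀ {s t : Site 2}, H.Adj s t → nᵢ ≤ supLevel x₀ s → supLevel x₀ s ≤ nₒ →
        s ∈ spinBandSites D x₀ nᵢ nₒ ∧ σ s = 1 := by
      intro s t hst h1 h2
      obtain ⟨hadj, hps, -, hccs, -⟩ := hHadj hst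
      exact hfree i₀ s (discreteDomainGraph_adj_iff.1 hadj).2.1 hps h1 h2 hccs
    obtain ⟨huU, hu1⟩ := hvert hw₀ hu.ge (hu.le.trans hnio.le)
    refine ⟨u, mem_spinBandIn.2 ⟨huU, hu⟩, huU, hu1, hcc₀, v, ?_, ?_⟩
    · -- `v` is the last vertex: it has an `H`-edge too
      have hlast : ∃ w, H.Adj v w := by
        have pth' := pth.reverse
        cases pth' with
        | nil => exact absurd rfl hne.symm
        | cons h _ => exact ⟨_, ((SimpleGraph.fromRel_adj _ _ _).1 h).2.elim (fun h ↦ h.1) (fun h ↦ h.1.symm)⟩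
      obtain ⟨w₁, hw₁⟩ := hlast
      exact mem_spinBandOut.2 ⟨(hvert hw₁ (hv ▸ hnio.le) hv.le).1, hv⟩
    · -- the band walk of `H` is a walk of the local `+` graph
      refine SimpleGraph.Reachable.mono ?_ ⟨pth⟩
      intro s t hst
      rw [SimpleGraph.fromRel_adj] at hst
      rw [plusGraph_adj]
      rcases hst.2 with ⟨h, h1, h2, h3, h4⟩ | ⟨h, h1, h2, h3, h4⟩
      · obtain ⟨hs, hs1⟩ := hvert h h1 h2
        obtain ⟨ht, ht1⟩ := hvert h.symm h3 h4
        exact ⟨meshGraph_le_zdGraph _ _ (discreteDomainGraph_le_meshGraph _ _ (hHadj h).1), hs, ht, hs1, ht1⟩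
      · obtain ⟨hs, hs1⟩ := hvert h.symm h3 h4
        obtain ⟨ht, ht1⟩ := hvert h h1 h2
        exact ⟨meshGraph_le_zdGraph _ _ (discreteDomainGraph_le_meshGraph _ _ (hHadj h).1.symm), hs, ht, hs1, ht1⟩
  choose rep hrepIn hrepU hrep1 hrepcc hrepw using harm
  -- locally `+`-reachable sites are in the same sector
  have hpath_cc : ∀ (a b : Site 2) (w : (plusGraph (zdGraph 2) (spinBandSites D x₀ nᵢ nₒ) σ).Walk a b),
      connectedComponentIn X (meshPoint D.δ a) = connectedComponentIn X (meshPoint D.δ b) := by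
    intro a b w
    induction w with
    | nil => rfl
    | @cons a b _ hab w' ih =>
      rw [← ih]
      obtain ⟨hadj, ha, hb, ha1, hb1⟩ := plusGraph_adj.1 hab
      obtain ⟨haI, ha2, ha3⟩ := mem_spinBandSites.1 ha
      obtain ⟨hbI, -, -⟩ := mem_spinBandSites.1 hb
      have haB : a ∉ D.zdBoundary := by
        have h := Finset.mem_coe.2 haI
        rw [coe_zdInteriorFinset hD.isBounded hδ] at h
        exact h.2
      have hbB : b ∉ D.zdBoundary := by
        have h := Finset.mem_coe.2 hbI
        rw [coe_zdInteriorFinset hD.isBounded hδ] at h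
        exact h.2
      have hpa : D.IsPlus σ a := Or.inr ⟨fun h ↦ haB (D.zdArcB_subset_zdBoundary h), ha1⟩
      have hpb : D.IsPlus σ b := Or.inr ⟨fun h ↦ hbB (D.zdArcB_subset_zdBoundary h), hb1⟩
      exact hstep hadj hpa hpb (hA𝔸 a ha2 ha3)
  have hreach_cc : ∀ {i₀ z}, (plusGraph (zdGraph 2) (spinBandSites D x₀ nᵢ nₒ) σ).Reachable (rep i₀) z →
      connectedComponentIn X (meshPoint D.δ z) = comp (L i₀) := by
    intro i₀ z ⟨pth⟩
    rw [← hrepcc i₀, hpath_cc _ _ pth]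
  have hrepinj : Function.Injective rep := by
    intro i₀ i₁ h
    by_contra hne
    apply hLne i₀ i₁ hne
    rw [← hrepcc, ← hrepcc, h]
  refine ⟨Finset.univ.image rep, ?_, ?_, ?_, ?_⟩
  · rw [Finset.card_image_of_injective _ hrepinj, Finset.card_univ, Fintype.card_fin]
  · intro v hv
    obtain ⟨i₀, -, rfl⟩ := Finset.mem_image.1 hv
    exact ⟨hrepIn i₀, hrepU i₀, hrep1 i₀, hrepw i₀⟩
  · intro v hv z hz hreach
    obtain ⟨i₀, -, rfl⟩ := Finset.mem_image.1 hv
    obtain ⟨hzU, y, hyA, hzy⟩ := mem_spinBandSeeds.1 hz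
    obtain ⟨hzI, hz1, hz2⟩ := mem_spinBandSites.1 hzU
    have hcc := hreach_cc hreach
    -- `z` is `+` (reached in the local `+` graph) and `y ∈ a_δ` is `+`: the edge `zy` keeps the component
    have hzplus1 : σ z = 1 := (mem_and_eq_one_of_reachable (hrepU i₀) (hrep1 i₀) hreach).2
    have hzB : z ∉ D.zdBoundary := by
      have h := Finset.mem_coe.2 hzI
      rw [coe_zdInteriorFinset hD.isBounded hδ] at h
      exact h.2
    have hpz : D.IsPlus σ z := Or.inr ⟨fun h ↦ hzB (D.zdArcB_subset_zdBoundary h), hzplus1⟩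
    have hpy : D.IsPlus σ y := Or.inl hyA
    obtain ⟨hlo, hhi⟩ := hband z hz1 hz2
    have hseg : segment ℝ (meshPoint D.δ z) (meshPoint D.δ y) ⊆ X := by
      intro w hw
      refine ⟨hA𝔸 z hz1 hz2 ?_, fun hwK ↦ Set.disjoint_left.1 (segment_disjoint_leftCut_of_isPlus hD σ hzy hpz hpy) hw hwK⟩
      have hd : dist (meshPoint D.δ y) (meshPoint D.δ z) ≤ D.δ := by
        rw [dist_comm, dist_meshPoint_of_adj hzy, abs_of_pos hδ]
      exact (convex_closedBall _ _).segment_subset (mem_closedBall.2 (by rw [dist_self]; exact hδ.le)) (mem_closedBall.2 hd) hw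
    have hyz : meshPoint D.δ y ∈ connectedComponentIn X (meshPoint D.δ z) :=
      (convex_segment (meshPoint D.δ z) (meshPoint D.δ y)).isPreconnected.subset_connectedComponentIn
        (left_mem_segment ℝ (meshPoint D.δ z) (meshPoint D.δ y)) hseg (right_mem_segment ℝ (meshPoint D.δ z) (meshPoint D.δ y))
    have hccy : connectedComponentIn X (meshPoint D.δ y) = comp (L i₀) := by
      rw [← hcc]
      exact (connectedComponentIn_eq hyz).symm
    have hdy : dist (meshPoint D.δ y) (meshPoint D.δ z) = D.δ := by rw [dist_comm, dist_meshPoint_of_adj hzy, abs_of_pos hδ]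
    have hylo : r₁ - 5 * D.δ < dist (meshPoint D.δ y) x := by
      linarith [dist_triangle (meshPoint D.δ z) (meshPoint D.δ y) x, dist_comm (meshPoint D.δ z) (meshPoint D.δ y)]
    have hyhi : dist (meshPoint D.δ y) x < r₂ + 5 * D.δ := by
      linarith [dist_triangle (meshPoint D.δ y) (meshPoint D.δ z) x]
    exact htaint_of_bdry i₀ y (D.zdArcA_subset_zdBoundary hyA) hylo hyhi hccy
  · intro v hv v' hv' hvv' hreach
    obtain ⟨i₀, -, rfl⟩ := Finset.mem_image.1 hv
    obtain ⟨i₁, -, rfl⟩ := Finset.mem_image.1 hv'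
    have hne : i₀ ≠ i₁ := fun h ↦ hvv' (by rw [h])
    apply hLne i₀ i₁ hne
    rw [← hreach_cc hreach, hrepcc]

end Literature.Probability.LatticeModels

end
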